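/-
Copyright (c) 2026 the pub-hodgecm-mathlib formalisation cell (harness21).  Prover seat hodgecm-mathlib-K2E4-p01 (g2), Track B ∕ K2-LIT,
h413 = `stmt-HodgeConjecture-24833`; road «(B)∣split» (HC density at the centre of `GL₂ × GL₁`), FILE B1.  2026-09-03.
-/
import Summits.HodgeConjecture.HodgeConjecture.Theorems.K2E3GLTwoRamifiedShellShift      -- ★ FILE A (this seat): shell shift, torus = centraliser, integrality test
import Literature.NumberTheory.Automorphic.SLTwoTreeProjectiveAction                     -- ★ `glVertexAct`, `isSpecialLattice_latt_of_valuation_det` (the root vertex)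
import Literature.NumberTheory.Automorphic.ReductiveGroupData                            -- ★ `glInt`, `isOpen_glInt`, `isCompact_glInt`
import HarnessLib

/-!
# h413 ∕ Track B «K2-LIT» — HC density at the centre of `GL₂(F) × GL₁(F)`, FILE B1: the double cosets `K_P \ P / C_P((γ, a))` are the SHELLS
# of the ramified torus, and their stabiliser weights are `q^r` (Labesse–Langlands 1979 §2)

Cell `pub/hodgecm-mathlib`, crux H413 = `stmt-HodgeConjecture-24833` (supports-only); E3 socket (B) `sig_K2E3CentralTransferVanishing` at a split place via
K2E4-p02 (g0)'s interface (HC₁^P).  `P = GL₂(F) × GL₁(F)`, `K_P = GL₂(𝒪) × GL₁(𝒪)`, Eisenstein torus `T = C(γτ)` (`γτ = (0, v; 1, u)`, `|u| < 1`, `|v| = |ϖ|`),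
`γ ∈ GL₂(F)` any element with `C(γ) = C(γτ)` (the deep elements `z(1 + ϖⁿτ)` of FILE A), `a ∈ GL₁(F)`, `Γ = (γ, a)`, `C = C_P(Γ) = T × GL₁(F)`,
shell representatives `X_r = (r_r⁻¹, 1)`, `r_r = diag(1, ϖ^r)`.

* §1 `P`-bookkeeping: `GL₁(F)` is commutative, `C_P((γ, a)) = {x | x.1 ∈ C(γ)}`, `C` is commutative.
* §2 **the double cosets `K_P \ P / C` are the shells**: `exists_shellIndex_prod` — an index `idx : P → ℕ` with `x ∈ K_P · X_{idx x} · C` and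
  `x ∈ K_P X_m C ⇒ idx x = m` (★ `exists_shellIndex` read through `x ↦ x.1⁻¹ · v₀`); values and stabiliser sets are constant on double cosets.
* §3 **weights**: the stabiliser subgroups `A_r = {c ∈ C | X_r c X_r⁻¹ ∈ K_P}` satisfy `A_r ≤ A_0` and `[A_0 : A_r] = q^r` (★ `relIndex_torusInt_shellStab_eq`
  pushed through the first projection) — `stab_le_and_relIndex_eq`; FILE B2 (`K2E3GLTwoRamifiedShellUnfolding`) turns this into the shell sum.

HONEST LABEL: HC_CM is proved only modulo the 7 printed citations (2 remaining named inputs: hLiu418 = `stmt-HodgeConjecture-24832`,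
h413 = `stmt-HodgeConjecture-24833`) until rung 0 closes; this file moves no counter.

## References
* [LabesseLanglands1979] J.-P. Labesse, R. P. Langlands, *L-indistinguishability for SL(2)*, Canad. J. Math. 31 (1979), §2 p. 8 (`T̃∖G̃∕K̃`, reps `diag(1, ϖ^m)`, `δ_m`).
* [Laumon1995] G. Laumon, *Cohomology of Drinfeld Modular Varieties* I (1996), Lemma (5.3.2) p. 136.
* [Rogawski1990] J. D. Rogawski, *Automorphic Representations of Unitary Groups in Three Variables* (1990), §4.9 p. 54.
-/

set_option autoImplicit false
set_option linter.dupNamespace false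

noncomputable section

open scoped ValuativeRel Matrix MatrixGroups
open Matrix ValuativeRel
open Literature.NumberTheory.Automorphic Literature.NumberTheory.Automorphic.HermitianLatticeTree
open Summit.HodgeConjecture.HodgeConjecture.Cruxes.H413.K2E3GLTwoRamifiedShellShift

namespace Summit.HodgeConjecture.HodgeConjecture.Cruxes.H413.K2E3GLTwoRamifiedShellStabilizers

variable {F : Type*} [Field F] [ValuativeRel F]

/-! ## §1 `P = GL₂(F) × GL₁(F)`: the centraliser of `(γ, a)` -/

section Pair

omit [ValuativeRel F] in
/-- `GL₁(F)` is commutative. [folklore] -/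
theorem glOne_mul_comm (a b : GL (Fin 1) F) : a * b = b * a := by
  refine Units.ext ?_
  rw [Units.val_mul, Units.val_mul]
  ext i j
  fin_cases i; fin_cases j
  simp [Matrix.mul_apply, mul_comm]

omit [ValuativeRel F] in
/-- `x ∈ C_P((γ, a)) ↔ x.1 ∈ C(γ)`. [folklore] -/
theorem mem_centralizer_pair_iff (γ : GL (Fin 2) F) (a : GL (Fin 1) F) (x : GL (Fin 2) F × GL (Fin 1) F) :
    x ∈ Subgroup.centralizer ({(γ, a)} : Set (GL (Fin 2) F × GL (Fin 1) F)) ↔ x.1 ∈ Subgroup.centralizer ({γ} : Set (GL (Fin 2) F)) := by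
  rw [Subgroup.mem_centralizer_singleton_iff, Subgroup.mem_centralizer_singleton_iff, Prod.ext_iff]
  simp only [Prod.fst_mul, Prod.snd_mul, glOne_mul_comm x.2 a, and_true]

omit [ValuativeRel F] in
/-- `C_P((γ, a))` is commutative when `C(γ) = C(γτ)` (FILE A `mul_comm_of_mem_centralizer_companion` + `GL₁` commutative). [cite: LabesseLanglands1979, §2 p. 7] -/
theorem centralizer_pair_mul_comm {u v : F} {γτ γ : GL (Fin 2) F} (hγτ : (γτ : Matrix (Fin 2) (Fin 2) F) = !![0, v; 1, u])
    (hC : Subgroup.centralizer ({γ} : Set (GL (Fin 2) F)) = Subgroup.centralizer ({γτ} : Set (GL (Fin 2) F))) (a : GL (Fin 1) F)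
    (x y : Subgroup.centralizer ({(γ, a)} : Set (GL (Fin 2) F × GL (Fin 1) F))) : x * y = y * x := by
  refine Subtype.ext (Prod.ext ?_ (glOne_mul_comm _ _))
  have hx := (mem_centralizer_pair_iff γ a x.1).1 x.2
  have hy := (mem_centralizer_pair_iff γ a y.1).1 y.2
  rw [hC] at hx hy
  exact mul_comm_of_mem_centralizer_companion hγτ hx hy

end Pair

/-! ## §2 The double cosets `K_P \ P / C` are indexed by the shells -/

section Shells

variable {ϖ : F} (hϖ : IsUniformizingElement ϖ) [IsDiscreteValuationRing 𝒪[F]]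

include hϖ in
/-- **THE SHELL INDEX ON `P`**: there is `idx : P → ℕ` such that every `x ∈ P` lies in `K_P · X_{idx x} · C` (`X_m = (r_m⁻¹, 1)`) and
`x ∈ K_P · X_m · C ⇒ idx x = m` — ★ `exists_shellIndex` (LL79 p. 8: `T∖GL₂(F)∕F^×GL₂(𝒪) ↔ ℕ`) read through the vertex `x.1⁻¹ · v₀`.
[cite: LabesseLanglands1979, §2 p. 8] -/
theorem exists_shellIndex_prod {u v : F} (hu : u ∈ 𝒪[F]) (hv : v ∈ 𝒪[F])
    (hE : ∀ p q : F, valuation F (p ^ 2 + p * q * u - q ^ 2 * v) ≤ 1 → p ∈ 𝒪[F] ∧ q ∈ 𝒪[F])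
    {γτ γ : GL (Fin 2) F} (hγτ : (γτ : Matrix (Fin 2) (Fin 2) F) = !![0, v; 1, u])
    (hC : Subgroup.centralizer ({γ} : Set (GL (Fin 2) F)) = Subgroup.centralizer ({γτ} : Set (GL (Fin 2) F))) (a : GL (Fin 1) F)
    (rm : ℕ → GL (Fin 2) F) (hrm : ∀ m, (rm m : Matrix (Fin 2) (Fin 2) F) = Matrix.diagonal ![1, ϖ ^ m]) :
    ∃ idx : GL (Fin 2) F × GL (Fin 1) F → ℕ,
      (∀ x, ∃ k ∈ (glInt 2 F).prod (glInt 1 F), ∃ c ∈ Subgroup.centralizer ({(γ, a)} : Set (GL (Fin 2) F × GL (Fin 1) F)),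
        x = k * ((rm (idx x))⁻¹, 1) * c) ∧
      (∀ (x k c : GL (Fin 2) F × GL (Fin 1) F) (m : ℕ), k ∈ (glInt 2 F).prod (glInt 1 F) →
        c ∈ Subgroup.centralizer ({(γ, a)} : Set (GL (Fin 2) F × GL (Fin 1) F)) → x = k * ((rm m)⁻¹, 1) * c → idx x = m) := by
  -- the root vertex `v₀ = [𝒪²]`
  have hsp : IsSpecialLattice (RingHom.id F) ϖ !![(0 : F), 1; -1, 0] (latt ((1 : GL (Fin 2) F) : Matrix (Fin 2) (Fin 2) F)) :=
    isSpecialLattice_latt_of_valuation_det hϖ.ne_zero 1 (e := 0) (Or.inl rfl) (by simp)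
  rw [Units.val_one] at hsp
  obtain ⟨d, hd, hd'⟩ := exists_shellIndex hϖ hu hv hE ⟨_, hsp⟩ rfl
  refine ⟨fun x => d (glVertexAct hϖ x.1⁻¹ ⟨_, hsp⟩), fun x => ?_, fun x k c m hk hc hx => ?_⟩
  · obtain ⟨t, gm, c, e, ht, hgm, hx⟩ := hd (glVertexAct hϖ x.1⁻¹ ⟨_, hsp⟩)
    obtain ⟨c', k, hk, hk'⟩ := exists_units_mul_glInt_of_glVertexAct_eq hϖ _ _ ⟨_, hsp⟩ rfl hx
    have hgm' : gm = rm (d (glVertexAct hϖ x.1⁻¹ ⟨_, hsp⟩)) := Units.ext (by rw [hgm, hrm])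
    set S := c'.map ((Matrix.scalar (Fin 2) : F →+* Matrix (Fin 2) (Fin 2) F) : F →* Matrix (Fin 2) (Fin 2) F) with hS
    have hSg : ∀ g : GL (Fin 2) F, S * g = g * S := fun g => by rw [hS]; exact units_map_scalar_mul_comm c' g
    have htC : t ∈ Subgroup.centralizer ({γτ} : Set (GL (Fin 2) F)) := regRep_mem_centralizer_companion hγτ ht
    have hSC : S ∈ Subgroup.centralizer ({γτ} : Set (GL (Fin 2) F)) := by
      rw [Subgroup.mem_centralizer_singleton_iff]; exact hSg γτ
    refine ⟨(k, 1), ⟨hk, Subgroup.one_mem _⟩, (S * t⁻¹, x.2), ?_, ?_⟩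
    · rw [mem_centralizer_pair_iff, hC]
      exact Subgroup.mul_mem _ hSC (Subgroup.inv_mem _ htC)
    · -- `t · gm = x.1⁻¹ · S · k` ⇒ `x.1 = k · gm⁻¹ · (S · t⁻¹)` (`S` central)
      have h1 : x.1 = S * k * gm⁻¹ * t⁻¹ := by
        have h2 : x.1 * (t * gm) = S * k := by rw [hk', mul_inv_cancel_left]
        rw [← h2]; group
      refine Prod.ext ?_ ?_
      · rw [Prod.fst_mul, Prod.fst_mul, ← hgm', h1]
        calc S * k * gm⁻¹ * t⁻¹ = S * (k * gm⁻¹) * t⁻¹ := by group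
          _ = (k * gm⁻¹) * S * t⁻¹ := by rw [hSg (k * gm⁻¹)]
          _ = k * gm⁻¹ * (S * t⁻¹) := by group
      · simp only [Prod.snd_mul, one_mul]
  · have hx1 : x.1⁻¹ = c.1⁻¹ * rm m * k.1⁻¹ := by
      rw [hx, Prod.fst_mul, Prod.fst_mul]; group
    have hk1 : k.1⁻¹ ∈ glInt 2 F := Subgroup.inv_mem _ hk.1
    have hc1 : c.1⁻¹ ∈ Subgroup.centralizer ({γτ} : Set (GL (Fin 2) F)) := by
      rw [← hC]; exact Subgroup.inv_mem _ ((mem_centralizer_pair_iff γ a c).1 hc)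
    obtain ⟨c'', e'', hce⟩ := exists_coe_eq_regRep_of_mem_centralizer_companion hγτ hc1
    have hvx : glVertexAct hϖ x.1⁻¹ ⟨_, hsp⟩ = glVertexAct hϖ (c.1⁻¹ * rm m) ⟨_, hsp⟩ := by
      rw [hx1, glVertexAct_mul hϖ (c.1⁻¹ * rm m), glVertexAct_root_eq_of_mem_glInt hϖ hk1 ⟨_, hsp⟩ rfl]
    exact hd' _ _ _ c'' e'' m hce (hrm m) hvx

omit [ValuativeRel F] [IsDiscreteValuationRing 𝒪[F]] in
/-- **The value of a `K_P`-conjugation-invariant function at `x Γ x⁻¹` depends only on the double coset `K_P x C`.** [cite: Laumon1995, Lemma (5.3.2) p. 136] -/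
theorem apply_conj_eq_of_eq_mul {X : Sort*} {KP C : Subgroup (GL (Fin 2) F × GL (Fin 1) F)} {Γ : GL (Fin 2) F × GL (Fin 1) F}
    (hΓ : C = Subgroup.centralizer ({Γ} : Set (GL (Fin 2) F × GL (Fin 1) F))) (ψ : GL (Fin 2) F × GL (Fin 1) F → X)
    (hψK : ∀ k ∈ KP, ∀ y, ψ (k * y * k⁻¹) = ψ y) {x k y c : GL (Fin 2) F × GL (Fin 1) F} (hk : k ∈ KP) (hc : c ∈ C) (hx : x = k * y * c) :
    ψ (x * Γ * x⁻¹) = ψ (y * Γ * y⁻¹) := by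
  subst hΓ
  have hcΓ : c * Γ * c⁻¹ = Γ := by
    rw [(Subgroup.mem_centralizer_singleton_iff.1 hc), mul_inv_cancel_right]
  have : x * Γ * x⁻¹ = k * (y * Γ * y⁻¹) * k⁻¹ := by
    rw [hx]
    conv_lhs => rw [show k * y * c * Γ * (k * y * c)⁻¹ = k * (y * (c * Γ * c⁻¹) * y⁻¹) * k⁻¹ by group]
    rw [hcΓ]
  rw [this, hψK k hk]

end Shells

/-! ## §3 Weights: the stabiliser subgroups `A_r = {c ∈ C | X_r c X_r⁻¹ ∈ K_P}` have `[A_0 : A_r] = q^r` -/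

section Weights

variable {ϖ : F} (hϖ : IsUniformizingElement ϖ) [IsDiscreteValuationRing 𝒪[F]]

omit [ValuativeRel F] [IsDiscreteValuationRing 𝒪[F]] in
/-- `r_0 = diag(1, ϖ⁰) = 1`, hence `X_0 = 1`. [folklore] -/
theorem shellRep_zero_eq_one {ϖ : F} {rm : ℕ → GL (Fin 2) F} (hrm : ∀ m, (rm m : Matrix (Fin 2) (Fin 2) F) = Matrix.diagonal ![1, ϖ ^ m]) :
    (((rm 0)⁻¹, 1) : GL (Fin 2) F × GL (Fin 1) F) = 1 := by
  have h : rm 0 = 1 := Units.ext (by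
    rw [hrm, pow_zero, Units.val_one, ← Matrix.diagonal_one]
    congr 1
    funext i
    fin_cases i <;> rfl)
  rw [h, inv_one]
  rfl

omit [ValuativeRel F] [IsDiscreteValuationRing 𝒪[F]] in
/-- Membership in the stabiliser subgroup `A_x = K_P.comap (conj x ∘ C.subtype)`: `c ∈ A_x ↔ x c x⁻¹ ∈ K_P`. [cite: Laumon1995, Lemma (5.3.2) p. 136] -/
theorem mem_stab_iff (KP C : Subgroup (GL (Fin 2) F × GL (Fin 1) F)) (x : GL (Fin 2) F × GL (Fin 1) F) (c : C) :
    c ∈ KP.comap ((MulAut.conj x).toMonoidHom.comp C.subtype) ↔ x * (c : GL (Fin 2) F × GL (Fin 1) F) * x⁻¹ ∈ KP := by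
  rw [Subgroup.mem_comap]
  rfl

omit [ValuativeRel F] [IsDiscreteValuationRing 𝒪[F]] in
/-- The stabiliser set of the unfolding (★ `orbitalIntegral_quotientMeasure_eq_sum_of_isClosed`) IS the carrier of `A_x`. [cite: Laumon1995, Lemma (5.3.2) p. 136] -/
theorem setOf_conj_mem_eq_coe_stab (KP C : Subgroup (GL (Fin 2) F × GL (Fin 1) F)) (x : GL (Fin 2) F × GL (Fin 1) F) :
    {c : C | x * (c : GL (Fin 2) F × GL (Fin 1) F) * x⁻¹ ∈ KP} = (KP.comap ((MulAut.conj x).toMonoidHom.comp C.subtype) : Set C) := by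
  ext c
  rw [Set.mem_setOf_eq, SetLike.mem_coe, mem_stab_iff]

omit [ValuativeRel F] [IsDiscreteValuationRing 𝒪[F]] in
/-- **The stabiliser subgroup is constant on double cosets** (`C` commutative): `A_{k y c} = A_y` for `k ∈ K_P`, `c ∈ C`. [cite: Laumon1995, Lemma (5.3.2) p. 136] -/
theorem stab_eq_of_eq_mul {KP C : Subgroup (GL (Fin 2) F × GL (Fin 1) F)} (hcomm : ∀ a b : C, a * b = b * a)
    {x k y c : GL (Fin 2) F × GL (Fin 1) F} (hk : k ∈ KP) (hc : c ∈ C) (hx : x = k * y * c) :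
    KP.comap ((MulAut.conj x).toMonoidHom.comp C.subtype) = KP.comap ((MulAut.conj y).toMonoidHom.comp C.subtype) := by
  ext c'
  rw [mem_stab_iff, mem_stab_iff, hx]
  have hcc : c * (c' : GL (Fin 2) F × GL (Fin 1) F) * c⁻¹ = c' := by
    have := congrArg Subtype.val (hcomm ⟨c, hc⟩ c')
    simp only [Subgroup.coe_mul] at this
    rw [this, mul_inv_cancel_right]
  have h1 : k * y * c * (c' : GL (Fin 2) F × GL (Fin 1) F) * (k * y * c)⁻¹ = k * (y * (c * (c' : GL (Fin 2) F × GL (Fin 1) F) * c⁻¹) * y⁻¹) * k⁻¹ := by group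
  rw [h1, hcc]
  constructor
  · intro h
    have := KP.mul_mem (KP.mul_mem (KP.inv_mem hk) h) hk
    simpa only [← mul_assoc, inv_mul_cancel, one_mul, inv_mul_cancel_right] using this
  · intro h
    exact KP.mul_mem (KP.mul_mem hk h) (KP.inv_mem hk)

include hϖ in
/-- **THE WEIGHT LAW `[A_0 : A_r] = q^r`** for the shell representative `X_r = (r_r⁻¹, 1)`: with `C = C_P((γ, a))`, `C(γ) = C(γτ)` (Eisenstein torus,
`u v ∈ 𝒪`, `|u| < 1`, `|v| = |ϖ|`) and `K_P = GL₂(𝒪) × GL₁(𝒪)`: `A_r ≤ A_0` (FILE A integrality test) and `A_r.relIndex A_0 = q^r`, where `A_0 = {c | c ∈ K_P}`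
is written as the stabiliser of `X = 1` — the stabiliser in `𝒪_E^× × 𝒪^×` of the shell-`r` vertex is `(𝒪 + ϖ^r 𝒪 τ)^× × 𝒪^×` (★ `relIndex_torusInt_shellStab_eq`,
LL79 `δ_r = 2q^r`).
[cite: LabesseLanglands1979, §2 p. 8] -/
theorem stab_le_and_relIndex_eq [Finite (IsLocalRing.ResidueField 𝒪[F])] {u v : F} (hu : u ∈ 𝒪[F]) (hu1 : valuation F u < 1)
    (hv1 : valuation F v = valuation F ϖ) {γτ γ : GL (Fin 2) F} (hγτ : (γτ : Matrix (Fin 2) (Fin 2) F) = !![0, v; 1, u])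
    (hC : Subgroup.centralizer ({γ} : Set (GL (Fin 2) F)) = Subgroup.centralizer ({γτ} : Set (GL (Fin 2) F))) (a : GL (Fin 1) F)
    {rm : ℕ → GL (Fin 2) F} (hrm : ∀ m, (rm m : Matrix (Fin 2) (Fin 2) F) = Matrix.diagonal ![1, ϖ ^ m]) (r : ℕ) :
    ((glInt 2 F).prod (glInt 1 F)).comap ((MulAut.conj (((rm r)⁻¹, 1) : GL (Fin 2) F × GL (Fin 1) F)).toMonoidHom.comp
        (Subgroup.centralizer ({(γ, a)} : Set (GL (Fin 2) F × GL (Fin 1) F))).subtype) ≤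
      ((glInt 2 F).prod (glInt 1 F)).comap ((MulAut.conj (1 : GL (Fin 2) F × GL (Fin 1) F)).toMonoidHom.comp
        (Subgroup.centralizer ({(γ, a)} : Set (GL (Fin 2) F × GL (Fin 1) F))).subtype) ∧
    (((glInt 2 F).prod (glInt 1 F)).comap ((MulAut.conj (((rm r)⁻¹, 1) : GL (Fin 2) F × GL (Fin 1) F)).toMonoidHom.comp
        (Subgroup.centralizer ({(γ, a)} : Set (GL (Fin 2) F × GL (Fin 1) F))).subtype)).relIndex
      (((glInt 2 F).prod (glInt 1 F)).comap ((MulAut.conj (1 : GL (Fin 2) F × GL (Fin 1) F)).toMonoidHom.comp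
        (Subgroup.centralizer ({(γ, a)} : Set (GL (Fin 2) F × GL (Fin 1) F))).subtype)) = Nat.card (IsLocalRing.ResidueField 𝒪[F]) ^ r := by
  have hv : v ∈ 𝒪[F] := by rw [Valuation.mem_integer_iff, hv1]; exact hϖ.valuation_le_one
  set C := Subgroup.centralizer ({(γ, a)} : Set (GL (Fin 2) F × GL (Fin 1) F)) with hCdef
  set KP := (glInt 2 F).prod (glInt 1 F) with hKP
  -- membership in the two stabilisers
  have hmemr : ∀ c : C, c ∈ KP.comap ((MulAut.conj (((rm r)⁻¹, 1) : GL (Fin 2) F × GL (Fin 1) F)).toMonoidHom.comp C.subtype) ↔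
      (rm r)⁻¹ * (c : GL (Fin 2) F × GL (Fin 1) F).1 * rm r ∈ glInt 2 F ∧ (c : GL (Fin 2) F × GL (Fin 1) F).2 ∈ glInt 1 F := by
    intro c
    rw [mem_stab_iff, hKP, Subgroup.mem_prod]
    simp only [Prod.inv_mk, inv_inv, inv_one, Prod.fst_mul, Prod.snd_mul, one_mul, mul_one]
  have hmem0 : ∀ c : C, c ∈ KP.comap ((MulAut.conj (1 : GL (Fin 2) F × GL (Fin 1) F)).toMonoidHom.comp C.subtype) ↔
      (c : GL (Fin 2) F × GL (Fin 1) F).1 ∈ glInt 2 F ∧ (c : GL (Fin 2) F × GL (Fin 1) F).2 ∈ glInt 1 F := by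
    intro c
    rw [mem_stab_iff, hKP, one_mul, inv_one, mul_one, Subgroup.mem_prod]
  have hc1 : ∀ c : C, (c : GL (Fin 2) F × GL (Fin 1) F).1 ∈ Subgroup.centralizer ({γτ} : Set (GL (Fin 2) F)) := fun c => by
    rw [← hC]; exact (mem_centralizer_pair_iff γ a _).1 c.2
  -- `A_r ≤ A_0`
  have hle : KP.comap ((MulAut.conj (((rm r)⁻¹, 1) : GL (Fin 2) F × GL (Fin 1) F)).toMonoidHom.comp C.subtype) ≤
      KP.comap ((MulAut.conj (1 : GL (Fin 2) F × GL (Fin 1) F)).toMonoidHom.comp C.subtype) := by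
    intro c hc
    rw [hmemr] at hc
    rw [hmem0]
    exact ⟨mem_glInt_of_mem_centralizer_companion_of_shellConj_mem hϖ hu hv hγτ (hc1 c) (hrm r) hc.1, hc.2⟩
  refine ⟨hle, ?_⟩
  -- the first projection `π : C → GL₂(F)` and the two integral tori
  set π : C →* GL (Fin 2) F := (MonoidHom.fst (GL (Fin 2) F) (GL (Fin 1) F)).comp C.subtype with hπ
  have hπ_apply : ∀ c : C, π c = (c : GL (Fin 2) F × GL (Fin 1) F).1 := fun c => rfl
  set TK := Subgroup.centralizer ({γτ} : Set (GL (Fin 2) F)) ⊓ glInt 2 F with hTK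
  set TKr' := (glInt 2 F).map (MulAut.conj (rm r)).toMonoidHom with hTKr'
  have hmemTKr' : ∀ g : GL (Fin 2) F, g ∈ TKr' ↔ (rm r)⁻¹ * g * rm r ∈ glInt 2 F := fun g => by
    rw [hTKr', Subgroup.mem_map_equiv, MulAut.conj_symm_apply]
  -- `A_r` and `TKr'.comap π` have the same trace on `A_0`
  set A0 := KP.comap ((MulAut.conj (1 : GL (Fin 2) F × GL (Fin 1) F)).toMonoidHom.comp C.subtype) with hA0
  set Ar := KP.comap ((MulAut.conj (((rm r)⁻¹, 1) : GL (Fin 2) F × GL (Fin 1) F)).toMonoidHom.comp C.subtype) with hAr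
  have hsub : Ar.subgroupOf A0 = (TKr'.comap π).subgroupOf A0 := by
    ext c
    rw [Subgroup.mem_subgroupOf, Subgroup.mem_subgroupOf, hmemr, Subgroup.mem_comap, hπ_apply, hmemTKr']
    exact ⟨fun h => h.1, fun h => ⟨h, ((hmem0 _).1 c.2).2⟩⟩
  -- `π(A_0) = TK`
  have hmap : A0.map π = TK := by
    ext g
    rw [Subgroup.mem_map, hTK, Subgroup.mem_inf]
    constructor
    · rintro ⟨c, hc, rfl⟩
      rw [hπ_apply]
      exact ⟨hc1 c, ((hmem0 c).1 hc).1⟩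
    · rintro ⟨hgT, hgK⟩
      have hgC : ((g, 1) : GL (Fin 2) F × GL (Fin 1) F) ∈ C := by
        rw [hCdef, mem_centralizer_pair_iff, hC]; exact hgT
      exact ⟨⟨(g, 1), hgC⟩, (hmem0 _).2 ⟨hgK, Subgroup.one_mem _⟩, rfl⟩
  rw [Subgroup.relIndex, hsub, ← Subgroup.relIndex, Subgroup.relIndex_comap, hmap, ← Subgroup.inf_relIndex_right TKr' TK, inf_comm, hTK, hTKr']
  exact relIndex_torusInt_shellStab_eq hϖ hu hu1 hv1 hγτ (hrm r)

end Weights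

end Summit.HodgeConjecture.HodgeConjecture.Cruxes.H413.K2E3GLTwoRamifiedShellStabilizers

end
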